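import Mathlib
import Literature.NumberTheory.LFunctions.Zhang2022.SkeletonAssembly
import HarnessLib

/-!
# Zhang (2022) §2, third part (pp. 8–12, tex L487–L696), STATEMENTS: Lemma 2.3's consequences
# (2.15)–(2.18), the test functions, (2.19)–(2.31), Propositions 2.4–2.6, (2.32)–(2.33), the proof
# of Lemma 2.3 step by step, and the Remark (2.34) — row `TypedSection01and02C` of the L1 plan

Topic `Literature/NumberTheory/LFunctions/Zhang2022` (Landau–Siegel audit tree; verdict-neutral).
Y. Zhang, *Discrete mean estimates and the Landau–Siegel zero*, arXiv:2211.02515v1 (2022)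
[Zhang2022LandauSiegel] — **an unrefereed manuscript under adjudication. Every `def … : Prop`
below is a CLAIM OF THE MANUSCRIPT, STATED NOT ASSERTED; nothing here asserts or denies
Theorems 1–2.** The `…_holds` / `…_of` theorems are kernel-checked discharges resp. edges from the
banked skeleton (`SkeletonAssembly`) and the tree. Campaign D-0069, layer L1, row owner L1-t3;
decls drafted by L1-t1 (marked "draft: L1-t1"), merged and audited against PDF pp. 8–12 by L1-t3.

Nodes of the row (`plan/DAG.tsv` ids) and their tokens — banked skeleton decls are CITED, never
restated (`HOME/skel/INTERFACE.md` §4):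

| node | page | token |
|---|---|---|
| `Z22:Lem2.3`, `§2.u024` | 8 | cited `Skeleton.Lemma23 c′` (proof node `Skeleton.Ded23`) |
| `(2.15)` | 8 | cited `Skeleton.omegaW` + `Eq215` (formula pin, "positive for `σ = 1/2`"), `eq215_holds` |
| `(2.16)` | 8 | `Eq216` + edge `eq216_of` (Prop. 2.2 (i) + Lemma 2.3 ⊢ (2.16)) |
| `§2.u025`, `§2.u026` | 8–9 | noted (expository forms `Σ_{n<P′} f(log n/log P′)μψ(n)n^{−s}`, `Σ_{n<P′} f(log n/log P)ψχ(n)n^{−s}` of the heuristic paragraph; no claim) |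
| `§2.u027` | 9 | objects `frakh1`, `frakh2` (the two test functions) |
| `(2.17)`, `(2.19)`, `(2.20)` | 9 | cited `Skeleton.xiStar1/2/3 c′` |
| `§2.u028`, `§2.u029`, `§2.u030` | 9 | `Step2u028` (`step2u028_holds`), `Step2u029` (edge `step2u029_of`), `Step2u030` (edge `step2u030_of`) |
| `(2.18)` | 9 | `Eq218` + edge `eq218_of` (= the skeleton's `norm_xiStar1_le_of`) |
| `(2.21)`–`(2.25)`, `(2.27)`–`(2.30)` | 10 | cited `Skeleton.P1/P2/P3`, `beta6/beta7`, `H11/H12/H13`, `H1/H2`, `ftilde`, `J1/J2`, `alphaTilde` |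
| `(2.26)` | 10 | cited tree `iota2/3/4` + `Eq226` (`eq226_holds`, digits verbatim) |
| `(2.31)`, `§2.u031` | 10 | cited `Skeleton.frakA` + `Eq231` (`eq231_holds`); "`𝔞 ≫ 1`" = cited `Skeleton.FrakALowerBound` (`frakALowerBound_holds`) |
| `Prop2.4`–`2.6`, `§2.u032`–`u034` | 11 | cited `Skeleton.Prop24/25/26 c′`; "a contradiction … proves Theorem 1" = `Skeleton.theorem1_of_props` |
| `(2.32)`, `(2.33)` | 11 | cited `Skeleton.Ineq232/233 c′`; "Prop. 2.5 follows … by Cauchy's inequality" = `CauchyXi2` + edge `cauchyXi2_of` (and `Skeleton.prop25_of_ineqs`) |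
| `Lem2.3.pf`, `§2.u035`–`u038` | 11–12 | cited `Skeleton.Ded23`; steps `Step2u035a`, `Step2u035`, `Step2u036`, `Step2u037`, `Step2u038`; edge `lemma23_of_steps` (steps ⊢ `Skeleton.Lemma23`) |
| `(2.34)` | 12 | `Eq234` |

Print defects inside the row, quoted not fixed: "By (2.)" (tex L667, p. 11: broken reference; the
gap assertion Prop. 2.2 (iii) in its restated form (2.13), p. 7, is meant); "`ρ ∈ 𝔷̃(ψ)`" (tex L531,
L690: macro collision with `Z̃` of §4; the zero set `𝔷(ψ)` of (2.14) is meant).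

## References
* Y. Zhang, arXiv:2211.02515v1 (2022), §2 pp. 8–12 (Lemma 2.3, (2.15)–(2.34), Props. 2.4–2.6).
  [cite: Zhang2022LandauSiegel, §2 pp. 8–12]
-/

noncomputable section

open Complex Real ComplexConjugate Filter
open scoped Topology

namespace Literature.NumberTheory.LFunctions.Zhang2022.Section2

open Literature.NumberTheory.LFunctions.Zhang2022 Skeleton GammaFactor

/-! ## p. 8: (2.15), (2.16) -/

/-- `Z22:(2.15)` [Z22 p.8, (2.15), tex L493] "`ω(s) = (√π/𝓛₂)exp{(s − s₀)²/(4𝓛₂²)}` with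
`𝓛₂ = 𝓛⁴⁰⁰`, which is positive for `σ = 1/2`": the skeleton's `omegaW D` (`= SmoothWeight.omega 𝓛₂ t₀`)
is this formula, and it is a positive real on the critical line (`D ≥ 3`, so `𝓛₂ > 0`). (draft: L1-t1)
[cite: Zhang2022LandauSiegel, §2 (2.15) p.8] -/
def Eq215 : Prop :=
  (∀ (D : ℕ) (s : ℂ), omegaW D s =
    ((Real.sqrt π / ell2 D : ℝ) : ℂ) * cexp ((s - s0 D) ^ 2 / (4 * (ell2 D : ℂ) ^ 2))) ∧
  (∀ (D : ℕ), 3 ≤ D → ∀ s : ℂ, s.re = 1 / 2 → 0 < (omegaW D s).re ∧ (omegaW D s).im = 0)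

/-- `Eq215` holds: by definition (`SmoothWeight.omega_def`) and `Skeleton.omegaW_re_pos`.
[cite: Zhang2022LandauSiegel, §2 (2.15) p.8] -/
theorem eq215_holds : Eq215 := ⟨fun _ _ => rfl, fun _ hD _ hs => omegaW_re_pos hD hs⟩

/-- `Eq215` — `_holds` alias of `eq215_holds` above under the fact's exact name (appended
2026-08-28, D-0026 bookkeeping: the proof term is the existing theorem of this file; no statement,
definition or attribute is edited; no new named fact; the ledger's debt table listed the fact
unproved). [cite: Zhang2022LandauSiegel, §2 (2.15) p.8] -/
theorem _root_.Literature.NumberTheory.LFunctions.Zhang2022.Section2.Eq215_holds : Eq215 :=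
  _root_.Literature.NumberTheory.LFunctions.Zhang2022.Section2.eq215_holds

/-- `Z22:(2.16)` [Z22 p.8, (2.16), tex L497] "Lemma 2.3 implies that
`Σ_{ψ∈Ψ₁}Σ_{ρ∈𝔷(ψ)} 𝔠*(ρ,ψ)|𝔥(ρ,ψ)|²ω(ρ) ≥ 0` for all functions `𝔥(s,ψ)` defined on `Ω`" (the double
sum is the skeleton's `Finset` sum over `idx χ`; `𝔠*`, `ω(ρ)` real). (draft: L1-t1)
[cite: Zhang2022LandauSiegel, §2 (2.16) p.8] -/
def Eq216 (c' : ℝ) : Prop :=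
  ForAllLarge fun D _ χ => ∀ 𝔥 : Chr D → ℂ → ℂ,
    0 ≤ ∑ i ∈ idx χ, (cstar c' D i.1 i.2).re * ‖𝔥 i.1 i.2‖ ^ 2 * (omegaW D i.2).re

/-- **Edge "Lemma 2.3 implies (2.16)"**: with Proposition 2.2 (i) (zeros on the line, for
`ω(ρ) > 0`) and Lemma 2.3 (`𝔠* ≥ 0`), every term is `≥ 0`. [cite: Zhang2022LandauSiegel, §2 (2.16) p.8] -/
theorem eq216_of {c' : ℝ} (h22 : Skeleton.Prop22i) (h23 : Skeleton.Lemma23 c') : Eq216 c' := by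
  obtain ⟨D₀, h⟩ := h22.and h23
  refine ⟨max D₀ 3, fun D _ χ hD hq hp 𝔥 => ?_⟩
  have hD3 : 3 ≤ D := le_trans (le_max_right _ _) hD
  obtain ⟨h22', h23'⟩ := h D χ (le_trans (le_max_left _ _) hD) hq hp
  obtain ⟨hc, hω, -⟩ :=
    pointwise_inputs c' χ hD3 h23' h22' (fun x => psiChiPrimitive_holds D χ x hD3 hp)
  exact Finset.sum_nonneg fun i hi =>
    mul_nonneg (mul_nonneg (hc i hi).2 (sq_nonneg _)) (hω i hi).1.le

/-! ## p. 9: the two test functions, the identity, (2.18) -/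

variable {D : ℕ} [NeZero D] (χ : DirichletCharacter ℂ D) (x : Chr D)

/-- `Z22:§2.u027` (first test function) [Z22 p.9, tex L522] "`𝔥(s,ψ) = H₁(s,ψ) + Z(s,χψ)H̄₂(s,ψ)`"
(the `𝔥` of (2.32)). (draft: L1-t1) [cite: Zhang2022LandauSiegel, §2 p.9 (before (2.17))] -/
def frakh1 (s : ℂ) : ℂ := H1 χ x s + Zpc χ x s * conj (H2 χ x s)

/-- `Z22:§2.u027` (second test function) [Z22 p.9, tex L522] "`𝔥(s,ψ) = J₁(s,ψ) + Z(s,χψ)J̄₂(s,ψ)`",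
typed with the printed `+`; note that (2.20), Proposition 2.6 and (11.1) use `J₁ − ZJ̄₂` (print, in
an expository paragraph). (draft: L1-t1) [cite: Zhang2022LandauSiegel, §2 p.9 (before (2.17))] -/
def frakh2 (s : ℂ) : ℂ := J1 χ x s + Zpc χ x s * conj (J2 χ x s)

/-- The left side of (2.32), `Skeleton.xi1`, IS the sum (2.16) for the test function `frakh1`.
[cite: Zhang2022LandauSiegel, §2 (2.32) p.11] -/
theorem xi1_eq_sum_frakh1 (c' : ℝ) : xi1 c' χ =
    ∑ i ∈ idx χ, (cstar c' D i.1 i.2).re * ‖frakh1 χ i.1 i.2‖ ^ 2 * (omegaW D i.2).re := rfl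

/-- `Z22:§2.u028` [Z22 p.9, tex L533] the identity
"`H₁J̄₁ + H̄₂J₂ = (H₁ + Z(ρ,χψ)H̄₂)J̄₁ − (Z(ρ,χψ)J̄₁ − J₂)H̄₂`" at `(ρ,ψ)` (an identity of complex
numbers). (draft: L1-t1) [cite: Zhang2022LandauSiegel, §2 p.9 (before (2.18))] -/
def Step2u028 : Prop :=
  ∀ (D : ℕ) [NeZero D] (χ : DirichletCharacter ℂ D) (x : Chr D) (ρ : ℂ),
    H1 χ x ρ * conj (J1 χ x ρ) + conj (H2 χ x ρ) * J2 χ x ρ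
      = (H1 χ x ρ + Zpc χ x ρ * conj (H2 χ x ρ)) * conj (J1 χ x ρ)
        - (Zpc χ x ρ * conj (J1 χ x ρ) - J2 χ x ρ) * conj (H2 χ x ρ)

/-- `Step2u028` holds (`ring`). [cite: Zhang2022LandauSiegel, §2 p.9] -/
theorem step2u028_holds : Step2u028 := by
  intro D _ χ x ρ
  ring

/-- `Step2u028` — `_holds` alias of `step2u028_holds` above under the fact's exact name (appended
2026-08-28, D-0026 bookkeeping: the proof term is the existing theorem of this file; no statement,
definition or attribute is edited; no new named fact; the ledger's debt table listed the fact
unproved). [cite: Zhang2022LandauSiegel, §2 p.9] -/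
theorem _root_.Literature.NumberTheory.LFunctions.Zhang2022.Section2.Step2u028_holds : Step2u028 :=
  _root_.Literature.NumberTheory.LFunctions.Zhang2022.Section2.step2u028_holds

/-- `|Z ā − b| = |a − Z b̄|` whenever `|Z| = 1`. [folklore] -/
private theorem norm_mul_conj_sub_eq {Z : ℂ} (hZ : ‖Z‖ = 1) (a b : ℂ) :
    ‖Z * conj a - b‖ = ‖a - Z * conj b‖ := by
  have hZZ : Z * conj Z = 1 := by
    rw [Complex.mul_conj, Complex.normSq_eq_norm_sq, hZ]
    simp
  have key : a - Z * conj b = Z * conj (Z * conj a - b) := by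
    rw [map_sub, map_mul, Complex.conj_conj]
    linear_combination (-a) * hZZ
  rw [key, norm_mul, hZ, one_mul, Complex.norm_conj]

/-- `Z22:§2.u029` [Z22 p.9, tex L539] "and `|Z(ρ,χψ)J̄₁(ρ,ψ) − J₂(ρ,ψ)| = |J₁(ρ,ψ) − Z(ρ,χψ)J̄₂(ρ,ψ)|`"
for `ψ ∈ Ψ₁`, `ρ ∈ 𝔷(ψ)` (printed `ρ ∈ 𝔷̃(ψ)`, read `𝔷(ψ)`; uses `|Z(ρ,χψ)| = 1` on the critical line).
(draft: L1-t1) [cite: Zhang2022LandauSiegel, §2 p.9 (before (2.18))] -/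
def Step2u029 : Prop :=
  ForAllLarge fun D _ χ => ∀ x ∈ PsiOne χ, ∀ ρ ∈ zeroSet D x,
    ‖Zpc χ x ρ * conj (J1 χ x ρ) - J2 χ x ρ‖ = ‖J1 χ x ρ - Zpc χ x ρ * conj (J2 χ x ρ)‖

/-- **Edge**: Proposition 2.2 (i) (zeros on the line) ⇒ `Step2u029`, via `|Z(ρ,ψχ)| = 1`
(`Skeleton.norm_Zpc_eq_one`, `ψχ` primitive by `psiChiPrimitive_holds`). [cite: Zhang2022LandauSiegel, §2 p.9] -/
theorem step2u029_of (h22 : Skeleton.Prop22i) : Step2u029 := by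
  obtain ⟨D₀, h⟩ := h22
  refine ⟨max D₀ 3, fun D _ χ hD hq hp x hx ρ hρ => ?_⟩
  have hD3 : 3 ≤ D := le_trans (le_max_right _ _) hD
  have hre : ρ.re = 1 / 2 := h D χ (le_trans (le_max_left _ _) hD) hq hp x hx ρ
    (mem_prodZeroSetOmega_of_mem_zeroSet χ hρ)
  have hZ : ‖Zpc χ x ρ‖ = 1 :=
    norm_Zpc_eq_one χ (psiChiPrimitive_holds D χ x hD3 hp) hre (im_pos_of_mem_zeroSet hD3 hρ)
  exact norm_mul_conj_sub_eq hZ _ _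

/-- `Z22:§2.u030` [Z22 p.9, tex L543] "it follows that
`|H₁J̄₁ + H̄₂J₂| ≤ |H₁ + Z(ρ,χψ)H̄₂||J₁| + |J₁ − Z(ρ,χψ)J̄₂||H₂|`" at `(ρ,ψ)`, `ψ ∈ Ψ₁`, `ρ ∈ 𝔷(ψ)`.
(draft: L1-t1) [cite: Zhang2022LandauSiegel, §2 p.9 (before (2.18))] -/
def Step2u030 : Prop :=
  ForAllLarge fun D _ χ => ∀ x ∈ PsiOne χ, ∀ ρ ∈ zeroSet D x,
    ‖H1 χ x ρ * conj (J1 χ x ρ) + conj (H2 χ x ρ) * J2 χ x ρ‖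
      ≤ ‖H1 χ x ρ + Zpc χ x ρ * conj (H2 χ x ρ)‖ * ‖J1 χ x ρ‖
        + ‖J1 χ x ρ - Zpc χ x ρ * conj (J2 χ x ρ)‖ * ‖H2 χ x ρ‖

/-- **Edge**: the identity `Step2u028` and `Step2u029` give `Step2u030` (triangle inequality).
[cite: Zhang2022LandauSiegel, §2 p.9] -/
theorem step2u030_of (h29 : Step2u029) : Step2u030 := by
  refine h29.mono fun D _ χ _ _ h x hx ρ hρ => ?_
  rw [step2u028_holds D χ x ρ]
  calc ‖(H1 χ x ρ + Zpc χ x ρ * conj (H2 χ x ρ)) * conj (J1 χ x ρ)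
          - (Zpc χ x ρ * conj (J1 χ x ρ) - J2 χ x ρ) * conj (H2 χ x ρ)‖
        ≤ ‖(H1 χ x ρ + Zpc χ x ρ * conj (H2 χ x ρ)) * conj (J1 χ x ρ)‖
          + ‖(Zpc χ x ρ * conj (J1 χ x ρ) - J2 χ x ρ) * conj (H2 χ x ρ)‖ := norm_sub_le _ _
    _ = ‖H1 χ x ρ + Zpc χ x ρ * conj (H2 χ x ρ)‖ * ‖J1 χ x ρ‖
          + ‖J1 χ x ρ - Zpc χ x ρ * conj (J2 χ x ρ)‖ * ‖H2 χ x ρ‖ := by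
        rw [norm_mul, norm_mul, Complex.norm_conj, Complex.norm_conj, h x hx ρ hρ]

/-- `Z22:(2.18)` [Z22 p.9, (2.18), tex L549] "This yields, by Lemma 2.3, `|Ξ₁*| ≤ Ξ₂* + Ξ₃*`"
(`Ξ₁*` (2.17), `Ξ₂*` (2.19), `Ξ₃*` (2.20) = `Skeleton.xiStar1/2/3 c′`), in the standing-quantifier form.
(draft: L1-t1) [cite: Zhang2022LandauSiegel, §2 (2.18) p.9] -/
def Eq218 (c' : ℝ) : Prop :=
  ForAllLarge fun _ _ χ => ‖xiStar1 c' χ‖ ≤ xiStar2 c' χ + xiStar3 c' χ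

/-- **Edge for (2.18)**: Proposition 2.2 (i) + Lemma 2.3 ⇒ (2.18) — the skeleton's kernel-checked
`norm_xiStar1_le_of` at each large modulus. [cite: Zhang2022LandauSiegel, §2 (2.18) p.9] -/
theorem eq218_of {c' : ℝ} (h22 : Skeleton.Prop22i) (h23 : Skeleton.Lemma23 c') : Eq218 c' := by
  obtain ⟨D₀, h⟩ := h22.and h23
  refine ⟨max D₀ 3, fun D _ χ hD hq hp => ?_⟩
  have hD3 : 3 ≤ D := le_trans (le_max_right _ _) hD
  obtain ⟨h22', h23'⟩ := h D χ (le_trans (le_max_left _ _) hD) hq hp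
  exact norm_xiStar1_le_of c' χ hD3 h23' h22' (fun x => psiChiPrimitive_holds D χ x hD3 hp)

/-! ## p. 10: the numerical constants (2.26) and `𝔞` (2.31) -/

/-- `Z22:(2.26)` [Z22 p.10, (2.26), tex L592] "`ι₂ = 0.94977 − 1.38995i`, `ι₃ = −1.00635 − 0.22789i`,
`ι₄ = −0.68738 + 1.60688i`" — the tree's `iota2`, `iota3`, `iota4` are these constants verbatim.
(draft: L1-t1) [cite: Zhang2022LandauSiegel, §2 (2.26) p.10] -/
def Eq226 : Prop :=
  iota2 = 0.94977 - 1.38995 * I ∧ iota3 = -1.00635 - 0.22789 * I ∧ iota4 = -0.68738 + 1.60688 * I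

/-- `Eq226` holds by definition. [cite: Zhang2022LandauSiegel, §2 (2.26) p.10] -/
theorem eq226_holds : Eq226 := ⟨rfl, rfl, rfl⟩

/-- `Eq226` — `_holds` alias of `eq226_holds` above under the fact's exact name (appended
2026-08-28, D-0026 bookkeeping: the proof term is the existing theorem of this file; no statement,
definition or attribute is edited; no new named fact; the ledger's debt table listed the fact
unproved). [cite: Zhang2022LandauSiegel, §2 (2.26) p.10] -/
theorem _root_.Literature.NumberTheory.LFunctions.Zhang2022.Section2.Eq226_holds : Eq226 :=
  _root_.Literature.NumberTheory.LFunctions.Zhang2022.Section2.eq226_holds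

/-- `Z22:(2.31)` [Z22 p.10, (2.31), tex L621] "`𝔞 = (6/π²)L′(1,χ)²∏_{q∣D} q/(q+1)`" — the skeleton's
`frakA χ` (`= Lemma171.frakA χ`; `L′(1,χ)` is real for real `χ`, typed through its real part) is
this product over the prime divisors `q` of `D`. (draft: L1-t1) [cite: Zhang2022LandauSiegel, §2 (2.31) p.10] -/
def Eq231 : Prop :=
  ∀ (D : ℕ) [NeZero D] (χ : DirichletCharacter ℂ D),
    frakA χ = 6 / π ^ 2 * (deriv χ.LFunction 1).re ^ 2 * ∏ q ∈ D.primeFactors, ((q : ℝ) / (q + 1))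

/-- `Eq231` holds by definition (`Lemma171.frakA_def`). [cite: Zhang2022LandauSiegel, §2 (2.31) p.10] -/
theorem eq231_holds : Eq231 := fun _ _ _ => rfl

/-- `Eq231` — `_holds` alias of `eq231_holds` above under the fact's exact name (appended
2026-08-28, D-0026 bookkeeping: the proof term is the existing theorem of this file; no statement,
definition or attribute is edited; no new named fact; the ledger's debt table listed the fact
unproved). [cite: Zhang2022LandauSiegel, §2 (2.31) p.10] -/
theorem _root_.Literature.NumberTheory.LFunctions.Zhang2022.Section2.Eq231_holds : Eq231 :=
  _root_.Literature.NumberTheory.LFunctions.Zhang2022.Section2.eq231_holds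

/-! ## p. 11: Cauchy's inequality behind "Proposition 2.5 follows from (2.32) and (2.33)" -/

/-- [Z22 p.11, tex L655–661] "Proposition 2.5 follows from the inequalities (2.32) and (2.33) by
Cauchy's inequality (and Lemma 2.3)" — the Cauchy–Schwarz step `(Ξ₂*)² ≤ Ξ₁ · Ξ_J` for the
non-negative weights `𝔠*(ρ,ψ)ω(ρ)` (`Ξ₁`, `Ξ_J` = the left sides of (2.32), (2.33), `Skeleton.xi1`,
`xiJ`). (draft: L1-t1) [cite: Zhang2022LandauSiegel, §2 p.11 (after (2.33))] -/
def CauchyXi2 (c' : ℝ) : Prop :=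
  ForAllLarge fun _ _ χ => xiStar2 c' χ ^ 2 ≤ xi1 c' χ * xiJ c' χ

/-- **Edge**: Proposition 2.2 (i) + Lemma 2.3 ⇒ `CauchyXi2` (the tree's abstract
`EndgameData.xiStar2_sq_le` on the skeleton's `endgame` package; `Skeleton.prop25_of_ineqs` then
gives Proposition 2.5 from (2.32), (2.33) since `0.001·3000 < 2²`). [cite: Zhang2022LandauSiegel, §2 p.11] -/
theorem cauchyXi2_of {c' : ℝ} (h22 : Skeleton.Prop22i) (h23 : Skeleton.Lemma23 c') : CauchyXi2 c' := by
  obtain ⟨D₀, h⟩ := h22.and h23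
  refine ⟨max D₀ 3, fun D _ χ hD hq hp => ?_⟩
  have hD3 : 3 ≤ D := le_trans (le_max_right _ _) hD
  obtain ⟨h22', h23'⟩ := h D χ (le_trans (le_max_left _ _) hD) hq hp
  obtain ⟨hc, hω, hZ⟩ :=
    pointwise_inputs c' χ hD3 h23' h22' (fun x => psiChiPrimitive_holds D χ x hD3 hp)
  let E := endgame c' χ (fun i hi => (hc i hi).2) (fun i hi => (hω i hi).1) hZ
  have h := E.xiStar2_sq_le
  rwa [endgame_xiStar2, endgame_xi1, endgame_xiJ] at h

/-! ## pp. 11–12: the proof of Lemma 2.3, step by step, and the Remark (2.34) -/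

/-- Proof of Lemma 2.3, first claim [Z22 p.11, tex L667] "By (2.) [sic: print defect; the gap
assertion, Proposition 2.2 (iii) restated, p. 7] we see that `M(ρ+iv,ψ) ≠ 0` if `|β₂| ≤ v ≤ |β₃|`"
(`ψ ∈ Ψ₁`, `ρ ∈ 𝔷(ψ)`); refines `Skeleton.Ded23` step 1. (draft: L1-t1)
[cite: Zhang2022LandauSiegel, §2 proof of Lemma 2.3 p.11] -/
def Step2u035a (c' : ℝ) : Prop :=
  ForAllLarge fun D _ χ => ∀ x ∈ PsiOne χ, ∀ ρ ∈ zeroSet D x, ∀ v : ℝ,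
    ‖beta2 c' D‖ ≤ v → v ≤ ‖beta3 c' D‖ → Mfun x.ψ (ρ + v * I) ≠ 0

/-- `Z22:§2.u035` [Z22 p.11, tex L668] "This implies, by the mean-value theorem, that
`M(ρ+β₂,ψ)M(ρ+β₃,ψ) > 0`, since `M(1/2+it,ψ)` is a real-valued continuous function in `t`"
(a real, positive product); refines `Skeleton.Ded23` step 2. (draft: L1-t1)
[cite: Zhang2022LandauSiegel, §2 proof of Lemma 2.3 p.11] -/
def Step2u035 (c' : ℝ) : Prop :=
  ForAllLarge fun D _ χ => ∀ x ∈ PsiOne χ, ∀ ρ ∈ zeroSet D x,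
    (Mfun x.ψ (ρ + beta2 c' D) * Mfun x.ψ (ρ + beta3 c' D)).im = 0 ∧
      0 < (Mfun x.ψ (ρ + beta2 c' D) * Mfun x.ψ (ρ + beta3 c' D)).re

/-- `Z22:§2.u036` [Z22 pp.11–12, tex L672] "Similarly we have `M(ρ+β₁,ψ)/M(ρ+iv,ψ) > 0` if
`0 < v ≤ |β₁|`" (a real, positive quotient); refines `Skeleton.Ded23` step 3. (draft: L1-t1)
[cite: Zhang2022LandauSiegel, §2 proof of Lemma 2.3 pp.11–12] -/
def Step2u036 (c' : ℝ) : Prop :=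
  ForAllLarge fun D _ χ => ∀ x ∈ PsiOne χ, ∀ ρ ∈ zeroSet D x, ∀ v : ℝ, 0 < v → v ≤ ‖beta1 c' D‖ →
    (Mfun x.ψ (ρ + beta1 c' D) / Mfun x.ψ (ρ + v * I)).im = 0 ∧
      0 < (Mfun x.ψ (ρ + beta1 c' D) / Mfun x.ψ (ρ + v * I)).re

/-- `Z22:§2.u037` [Z22 p.12, tex L676] "Since
`M(ρ+β₁,ψ)/(iM′(ρ,ψ)) = lim_{v→0⁺} vM(ρ+β₁,ψ)/M(ρ+iv,ψ)`"; refines `Skeleton.Ded23` step 4.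
(draft: L1-t1) [cite: Zhang2022LandauSiegel, §2 proof of Lemma 2.3 p.12] -/
def Step2u037 (c' : ℝ) : Prop :=
  ForAllLarge fun D _ χ => ∀ x ∈ PsiOne χ, ∀ ρ ∈ zeroSet D x,
    Tendsto (fun v : ℝ => (v : ℂ) * Mfun x.ψ (ρ + beta1 c' D) / Mfun x.ψ (ρ + v * I))
      (𝓝[>] 0) (𝓝 (Mfun x.ψ (ρ + beta1 c' D) / (I * deriv (Mfun x.ψ) ρ)))

/-- `Z22:§2.u038` [Z22 p.12, tex L680] "it follows that `M(ρ+β₁,ψ)/(iM′(ρ,ψ)) ≥ 0`"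
(a non-negative real); refines `Skeleton.Ded23` step 5. (draft: L1-t1)
[cite: Zhang2022LandauSiegel, §2 proof of Lemma 2.3 p.12] -/
def Step2u038 (c' : ℝ) : Prop :=
  ForAllLarge fun D _ χ => ∀ x ∈ PsiOne χ, ∀ ρ ∈ zeroSet D x,
    (Mfun x.ψ (ρ + beta1 c' D) / (I * deriv (Mfun x.ψ) ρ)).im = 0 ∧
      0 ≤ (Mfun x.ψ (ρ + beta1 c' D) / (I * deriv (Mfun x.ψ) ρ)).re

/-- **Edge closing the proof of Lemma 2.3** [Z22 p.12, tex L683 "This completes the proof"]: the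
steps `M(ρ+β₂)M(ρ+β₃) > 0` and `M(ρ+β₁)/(iM′(ρ)) ≥ 0` give
`𝔠*(ρ,ψ) = [M(ρ+β₁)/(iM′(ρ))]·[M(ρ+β₂)M(ρ+β₃)]` real and `≥ 0`, i.e. the skeleton node `Lemma23 c′`
(refines `Skeleton.Ded23`: last step). [cite: Zhang2022LandauSiegel, §2 proof of Lemma 2.3 p.12] -/
theorem lemma23_of_steps {c' : ℝ} (h35 : Step2u035 c') (h38 : Step2u038 c') :
    Skeleton.Lemma23 c' := by
  obtain ⟨D₀, h⟩ := h35.and h38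
  refine ⟨D₀, fun D _ χ hD hq hp x hx ρ hρ => ?_⟩
  obtain ⟨h35', h38'⟩ := h D χ hD hq hp
  obtain ⟨hwi, hwr⟩ := h35' x hx ρ hρ
  obtain ⟨hqi, hqr⟩ := h38' x hx ρ hρ
  set M₁ := Mfun x.ψ (ρ + beta1 c' D) with hM₁
  set M₂ := Mfun x.ψ (ρ + beta2 c' D) with hM₂
  set M₃ := Mfun x.ψ (ρ + beta3 c' D) with hM₃
  set M' := deriv (Mfun x.ψ) ρ with hM'
  have key : cstar c' D x ρ = M₁ / (I * M') * (M₂ * M₃) := by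
    rw [show cstar c' D x ρ = -I * M₁ * M₂ * M₃ / M' from rfl]
    rcases eq_or_ne M' 0 with h0 | h0
    · rw [h0]; simp
    · rw [div_mul_eq_mul_div, div_eq_div_iff h0 (mul_ne_zero I_ne_zero h0)]
      linear_combination (-(M₁ * M₂ * M₃ * M')) * I_sq
  refine ⟨?_, ?_⟩
  · rw [key, Complex.mul_im, hwi, hqi]
    ring
  · rw [key, Complex.mul_re, hwi, hqi]
    simpa using mul_nonneg hqr hwr.le

/-- `Z22:(2.34)` (Remark) [Z22 p.12, (2.34), tex L687] "It is implied in the proof of Lemma 2.3 that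
`|L(ρ+β₁,ψ)/L′(ρ,ψ)| = −iM(ρ+β₁,ψ)/M′(ρ,ψ)` for `ψ ∈ Ψ₁` and `ρ ∈ 𝔷(ψ)`" (printed `𝔷̃(ψ)`, read
`𝔷(ψ)`; used again on p. 75). (draft: L1-t1) [cite: Zhang2022LandauSiegel, §2 (2.34) p.12] -/
def Eq234 (c' : ℝ) : Prop :=
  ForAllLarge fun D _ χ => ∀ x ∈ PsiOne χ, ∀ ρ ∈ zeroSet D x,
    ((‖x.ψ.LFunction (ρ + beta1 c' D) / deriv x.ψ.LFunction ρ‖ : ℝ) : ℂ)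
      = -I * Mfun x.ψ (ρ + beta1 c' D) / deriv (Mfun x.ψ) ρ

end Literature.NumberTheory.LFunctions.Zhang2022.Section2
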